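import Literature.NumberTheory.DiophantineGeometry.PastenSubexpDecomposition
import HarnessLib

/-!
# Pasten's subexponential abc bounds, II: the quantity `B = exp √((log R) log₂ R)`

Topic `NumberTheory/DiophantineGeometry`; namespace `Literature.NumberTheory.DiophantineGeometry.Pasten`.

Pasten, Invent. Math. 236 (2024), §§3–5 [cite: Pasten2024, §4] works throughout with
`B = exp(√((log R) · log₂ R))` (`log₂ = log log`), assuming `R` "large enough". With the
notation `sfun R = √((log R)(log log R))`, `bfun R = exp (sfun R)` and the explicit threshold
`Lstar K κ` on `L = log R` of `PastenSubexpDecomposition` (depending on the two absolute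
constants `K` of Theorem 2.1 and `κ` of Theorem 2.5 with `ε = 1/3`), this file proves the
elementary real inequalities used in the deduction of Theorem 1.4: for `L ≥ Lstar K κ`,
`1 ≤ log L`, `log(64K) ≤ log L`, `log L ≤ s ≤ L/12` (`s = √(L log L)`), `L ≤ B`, and the
"self-improvement" `z ≤ A · log max{e, z} ⟹ z ≤ max{e, 4A²}` together with the numerical
inequality `ℓ + Y ≤ 5Yℓ²` (`ℓ ≥ log 2`, `Y ≥ 1`) used at the place `p₀`. No number theory here.
(Junk values: Mathlib's `Real.log` vanishes at non-positive arguments and `Real.sqrt` at negative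
ones, so `sfun R = 0`, `bfun R = 1` for `R ≤ e`; every statement below assumes `L ≥ L⋆ ≥ 82944`,
where `log L ≥ 1` and these junk values never occur.)

## References

* [Pasten2024] H. Pasten, Invent. Math. 236 (2024), 373–385, doi:10.1007/s00222-024-01244-6,
  arXiv:2312.03566 — §§3–5.
-/

noncomputable section

open Real

namespace Literature.NumberTheory.DiophantineGeometry.Pasten

/-! ### Consequences of `L ≥ L⋆` -/

section threshold

variable {K κ L : ℝ}

/-- `L ≥ 82944`. [folklore] -/
theorem large_le_of_Lstar_le (hL : Lstar K κ ≤ L) : 82944 ≤ L :=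
  le_trans (le_trans (le_max_left _ _) (le_max_left _ _)) hL

/-- `64K ≤ L`. [folklore] -/
theorem sixtyFour_mul_le_of_Lstar_le (hL : Lstar K κ ≤ L) : 64 * K ≤ L :=
  le_trans (le_trans (le_max_right _ _) (le_max_left _ _)) hL

/-- `1 ≤ L`. [folklore] -/
theorem one_le_of_Lstar_le (hL : Lstar K κ ≤ L) : 1 ≤ L :=
  le_trans (by norm_num) (large_le_of_Lstar_le hL)

/-- `0 < L`. [folklore] -/
theorem pos_of_Lstar_le (hL : Lstar K κ ≤ L) : 0 < L :=
  lt_of_lt_of_le one_pos (one_le_of_Lstar_le hL)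

/-- `1 ≤ log L` (as `L ≥ e`). [folklore] -/
theorem one_le_log_of_Lstar_le (hL : Lstar K κ ≤ L) : 1 ≤ Real.log L := by
  rw [← Real.log_exp 1]
  refine Real.log_le_log (Real.exp_pos 1) (le_trans ?_ (large_le_of_Lstar_le hL))
  have := Real.exp_one_lt_d9
  linarith

/-- `log(64K) ≤ log L` (for `K ≥ 1`). [folklore] -/
theorem log_sixtyFour_mul_le_log_of_Lstar_le (hK : 1 ≤ K) (hL : Lstar K κ ≤ L) :
    Real.log (64 * K) ≤ Real.log L :=
  Real.log_le_log (by linarith) (sixtyFour_mul_le_of_Lstar_le hL)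

/-- `log K ≤ log L` (for `K ≥ 1`). [folklore] -/
theorem log_le_log_of_Lstar_le (hK : 1 ≤ K) (hL : Lstar K κ ≤ L) : Real.log K ≤ Real.log L :=
  Real.log_le_log (by linarith) (by linarith [sixtyFour_mul_le_of_Lstar_le hL])

/-- `s² = L · log L`. [folklore] -/
theorem sq_sqrt_mul_log_of_Lstar_le (hL : Lstar K κ ≤ L) :
    Real.sqrt (L * Real.log L) ^ 2 = L * Real.log L :=
  Real.sq_sqrt (mul_nonneg (pos_of_Lstar_le hL).le
    (zero_le_one.trans (one_le_log_of_Lstar_le hL)))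

/-- `0 < s`. [folklore] -/
theorem sqrt_mul_log_pos_of_Lstar_le (hL : Lstar K κ ≤ L) : 0 < Real.sqrt (L * Real.log L) :=
  Real.sqrt_pos.mpr (mul_pos (pos_of_Lstar_le hL)
    (lt_of_lt_of_le one_pos (one_le_log_of_Lstar_le hL)))

/-- `log L ≤ s = √(L log L)` (since `log L ≤ L`). [folklore] -/
theorem log_le_sqrt_mul_log_of_Lstar_le (hL : Lstar K κ ≤ L) :
    Real.log L ≤ Real.sqrt (L * Real.log L) := by
  have hS : 0 ≤ Real.log L := zero_le_one.trans (one_le_log_of_Lstar_le hL)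
  have hSL : Real.log L ≤ L := by linarith [Real.log_le_sub_one_of_pos (pos_of_Lstar_le hL)]
  calc Real.log L = Real.sqrt (Real.log L * Real.log L) := (Real.sqrt_mul_self hS).symm
    _ ≤ Real.sqrt (L * Real.log L) := Real.sqrt_le_sqrt (mul_le_mul_of_nonneg_right hSL hS)

/-- `12 s ≤ L` (since `144 log L ≤ 288 √L ≤ L` for `L ≥ 82944 = 288²`). [folklore] -/
theorem twelve_mul_sqrt_mul_log_le_of_Lstar_le (hL : Lstar K κ ≤ L) :
    12 * Real.sqrt (L * Real.log L) ≤ L := by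
  have hL0 : 0 < L := pos_of_Lstar_le hL
  have hbig : 82944 ≤ L := large_le_of_Lstar_le hL
  have hS : 0 ≤ Real.log L := zero_le_one.trans (one_le_log_of_Lstar_le hL)
  -- `log L ≤ 2 √L`
  have hlog : Real.log L ≤ 2 * Real.sqrt L := by
    have := Real.log_le_rpow_div hL0.le (by norm_num : (0 : ℝ) < 1 / 2)
    rw [Real.sqrt_eq_rpow]
    linarith
  -- `288 √L ≤ L`
  have hsqrt : 288 * Real.sqrt L ≤ L := by
    have h1 : (288 : ℝ) ≤ Real.sqrt L := by
      rw [show (288 : ℝ) = Real.sqrt (288 ^ 2) by rw [Real.sqrt_sq]; norm_num]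
      exact Real.sqrt_le_sqrt (by norm_num; linarith)
    calc 288 * Real.sqrt L ≤ Real.sqrt L * Real.sqrt L :=
          mul_le_mul_of_nonneg_right h1 (Real.sqrt_nonneg L)
      _ = L := Real.mul_self_sqrt hL0.le
  have h144 : 144 * Real.log L ≤ L := by linarith
  -- `s ≤ √(L · L/144) = L/12`
  calc 12 * Real.sqrt (L * Real.log L) ≤ 12 * Real.sqrt (L * (L / 144)) :=
        mul_le_mul_of_nonneg_left (Real.sqrt_le_sqrt (by nlinarith)) (by norm_num)
    _ = 12 * (L / 12) := by
        rw [show L * (L / 144) = (L / 12) ^ 2 by ring, Real.sqrt_sq (by linarith)]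
    _ = L := by ring

/-- `L ≤ B = exp s`. [folklore] -/
theorem le_exp_sqrt_mul_log_of_Lstar_le (hL : Lstar K κ ≤ L) :
    L ≤ Real.exp (Real.sqrt (L * Real.log L)) := by
  calc L = Real.exp (Real.log L) := (Real.exp_log (pos_of_Lstar_le hL)).symm
    _ ≤ Real.exp (Real.sqrt (L * Real.log L)) :=
        Real.exp_le_exp.mpr (log_le_sqrt_mul_log_of_Lstar_le hL)

/-- `64K ≤ B`. [folklore] -/
theorem sixtyFour_mul_le_exp_of_Lstar_le (hL : Lstar K κ ≤ L) :
    64 * K ≤ Real.exp (Real.sqrt (L * Real.log L)) :=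
  (sixtyFour_mul_le_of_Lstar_le hL).trans (le_exp_sqrt_mul_log_of_Lstar_le hL)

/-- `(K · L)^t ≤ exp(8 s)` as soon as `t · s ≤ 4 L` (`t` = number of big primes).
[cite: Pasten2024, §4] -/
theorem mul_pow_le_exp_of_Lstar_le (hK : 1 ≤ K) (hL : Lstar K κ ≤ L) {t : ℕ}
    (ht : t * Real.sqrt (L * Real.log L) ≤ 4 * L) :
    (K * L) ^ t ≤ Real.exp (8 * Real.sqrt (L * Real.log L)) := by
  set s := Real.sqrt (L * Real.log L) with hs
  have hL0 : 0 < L := pos_of_Lstar_le hL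
  have hK0 : 0 < K := lt_of_lt_of_le one_pos hK
  have hs0 : 0 < s := sqrt_mul_log_pos_of_Lstar_le hL
  have hlogK : Real.log K ≤ Real.log L := log_le_log_of_Lstar_le hK hL
  have ht0 : (0 : ℝ) ≤ t := Nat.cast_nonneg t
  -- `t · log L ≤ 4 s`
  have htS : t * Real.log L ≤ 4 * s := by
    have h1 : t * Real.log L * s ≤ 4 * s * s := by
      calc t * Real.log L * s = t * s * Real.log L := by ring
        _ ≤ 4 * L * Real.log L :=
            mul_le_mul_of_nonneg_right ht (zero_le_one.trans (one_le_log_of_Lstar_le hL))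
        _ = 4 * s * s := by
            rw [mul_assoc 4 s s, ← pow_two, hs, sq_sqrt_mul_log_of_Lstar_le hL]; ring
    exact le_of_mul_le_mul_right h1 hs0
  calc (K * L) ^ t = Real.exp (t * (Real.log K + Real.log L)) := by
        rw [← Real.log_mul hK0.ne' hL0.ne', Real.exp_nat_mul, Real.exp_log (mul_pos hK0 hL0)]
    _ ≤ Real.exp (8 * s) := by
        apply Real.exp_le_exp.mpr
        nlinarith


/-- `c₀ K L ≤ B²` for `0 ≤ c₀ ≤ 64`. [folklore] -/
theorem const_mul_mul_le_exp_sq (hK : 1 ≤ K) (hL : Lstar K κ ≤ L) {c₀ : ℝ}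
    (hc : c₀ ≤ 64) : c₀ * K * L ≤ Real.exp (Real.sqrt (L * Real.log L)) ^ 2 := by
  have hB := sixtyFour_mul_le_exp_of_Lstar_le hL
  have hLB := le_exp_sqrt_mul_log_of_Lstar_le hL
  have hL0 := pos_of_Lstar_le hL
  have hK0 : 0 ≤ K := zero_le_one.trans hK
  calc c₀ * K * L ≤ 64 * K * L := by gcongr
    _ ≤ Real.exp (Real.sqrt (L * Real.log L)) * Real.exp (Real.sqrt (L * Real.log L)) :=
        mul_le_mul hB hLB hL0.le (Real.exp_pos _).le
    _ = _ := by ring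

/-- `c₀ K L² ≤ B³` for `0 ≤ c₀ ≤ 64`. [folklore] -/
theorem const_mul_mul_sq_le_exp_cube (hK : 1 ≤ K) (hL : Lstar K κ ≤ L) {c₀ : ℝ}
    (hc : c₀ ≤ 64) : c₀ * K * L ^ 2 ≤ Real.exp (Real.sqrt (L * Real.log L)) ^ 3 := by
  have h2 := const_mul_mul_le_exp_sq hK hL hc
  have hLB := le_exp_sqrt_mul_log_of_Lstar_le hL
  have hL0 := pos_of_Lstar_le hL
  calc c₀ * K * L ^ 2 = c₀ * K * L * L := by ring
    _ ≤ Real.exp (Real.sqrt (L * Real.log L)) ^ 2 * Real.exp (Real.sqrt (L * Real.log L)) :=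
        mul_le_mul h2 hLB hL0.le (pow_nonneg (Real.exp_pos _).le 2)
    _ = _ := by ring

/-- `c₀ K L B^{10} ≤ R = exp L` for `0 < c₀ ≤ 64` (exponent `log(c₀K) + log L + 10 s ≤ 12 s ≤ L`).
[folklore] -/
theorem const_mul_mul_mul_pow_le_exp (hK : 1 ≤ K) (hL : Lstar K κ ≤ L) {c₀ : ℝ} (hc₀ : 0 < c₀)
    (hc : c₀ ≤ 64) :
    c₀ * K * L * Real.exp (Real.sqrt (L * Real.log L)) ^ 10 ≤ Real.exp L := by
  set s := Real.sqrt (L * Real.log L) with hs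
  have hL0 := pos_of_Lstar_le hL
  have hK0 : 0 < K := lt_of_lt_of_le one_pos hK
  have h12 := twelve_mul_sqrt_mul_log_le_of_Lstar_le hL
  have hlogL := log_le_sqrt_mul_log_of_Lstar_le hL
  have hlogK : Real.log (c₀ * K) ≤ Real.log L :=
    (Real.log_le_log (mul_pos hc₀ hK0) (by nlinarith)).trans
      (log_sixtyFour_mul_le_log_of_Lstar_le hK hL)
  have hexp : c₀ * K * L * Real.exp s ^ 10 =
      Real.exp (Real.log (c₀ * K) + Real.log L + 10 * s) := by
    rw [Real.exp_add, Real.exp_add, Real.exp_log (mul_pos hc₀ hK0), Real.exp_log hL0,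
      show (10 : ℝ) * s = ((10 : ℕ) : ℝ) * s by norm_num, Real.exp_nat_mul]
  rw [hexp]
  exact Real.exp_le_exp.mpr (by linarith)

end threshold

/-! ### Two elementary inequalities -/

/-- Self-improvement: `z ≤ A · log max{e, z}` forces `z ≤ max{e, 4A²}` (via `log z ≤ 2√z`).
[folklore] -/
theorem le_max_of_le_mul_log_max {A z : ℝ} (hA : 0 ≤ A)
    (h : z ≤ A * Real.log (max (Real.exp 1) z)) : z ≤ max (Real.exp 1) (4 * A ^ 2) := by
  rcases le_or_gt z (Real.exp 1) with hz | hz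
  · exact hz.trans (le_max_left _ _)
  · have hz0 : 0 < z := (Real.exp_pos 1).trans hz
    rw [max_eq_right hz.le] at h
    have hlog : Real.log z ≤ 2 * Real.sqrt z := by
      have := Real.log_le_rpow_div hz0.le (by norm_num : (0 : ℝ) < 1 / 2)
      rw [Real.sqrt_eq_rpow]
      linarith
    have h2 : z ≤ 2 * A * Real.sqrt z := by nlinarith
    have hsz : 0 < Real.sqrt z := Real.sqrt_pos.mpr hz0
    have hs : Real.sqrt z ≤ 2 * A := by
      have : Real.sqrt z * Real.sqrt z ≤ 2 * A * Real.sqrt z := by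
        rw [Real.mul_self_sqrt hz0.le]; exact h2
      exact le_of_mul_le_mul_right this hsz
    calc z = Real.sqrt z ^ 2 := (Real.sq_sqrt hz0.le).symm
      _ ≤ (2 * A) ^ 2 := pow_le_pow_left₀ (Real.sqrt_nonneg z) hs 2
      _ = 4 * A ^ 2 := by ring
      _ ≤ max (Real.exp 1) (4 * A ^ 2) := le_max_right _ _

/-- `ℓ + Y ≤ 5 Y ℓ²` for `ℓ ≥ log 2` and `Y ≥ 1` (numerics at the place `p₀`, `ℓ = log p₀`).
[folklore] -/
theorem add_le_five_mul_mul_sq {ℓ Y : ℝ} (hℓ : Real.log 2 ≤ ℓ) (hY : 1 ≤ Y) :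
    ℓ + Y ≤ 5 * Y * ℓ ^ 2 := by
  have h2 : (0.6931 : ℝ) ≤ ℓ := le_trans (by have := Real.log_two_gt_d9; linarith) hℓ
  have h5 : (0 : ℝ) ≤ 5 * ℓ ^ 2 - 1 := by nlinarith
  nlinarith [mul_nonneg (sub_nonneg.mpr hY) h5]

/-- From `ν · ℓ < Θ · (p/ℓ) · (ℓ + Y)` (`ℓ = log p ≥ log 2`, `Y ≥ 1`) to `ν < 5 Θ p Y`.
[cite: Pasten2024, §5] -/
theorem lt_five_mul_of_mul_log_lt {ν ℓ Θ p Y : ℝ} (hℓ : Real.log 2 ≤ ℓ) (hY : 1 ≤ Y)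
    (hΘ : 0 ≤ Θ) (hp : 0 ≤ p) (h : ν * ℓ < Θ * (p / ℓ * (ℓ + Y))) : ν < 5 * Θ * p * Y := by
  have hℓ0 : 0 < ℓ := lt_of_lt_of_le (Real.log_pos one_lt_two) hℓ
  have key : Θ * (p / ℓ * (ℓ + Y)) ≤ 5 * Θ * p * Y * ℓ := by
    rw [show Θ * (p / ℓ * (ℓ + Y)) = Θ * p * ((ℓ + Y) / ℓ) by ring,
      show 5 * Θ * p * Y * ℓ = Θ * p * (5 * Y * ℓ) by ring]
    apply mul_le_mul_of_nonneg_left _ (mul_nonneg hΘ hp)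
    rw [div_le_iff₀ hℓ0]
    calc ℓ + Y ≤ 5 * Y * ℓ ^ 2 := add_le_five_mul_mul_sq hℓ hY
      _ = 5 * Y * ℓ * ℓ := by ring
  exact lt_of_mul_lt_mul_right (h.trans_le key) hℓ0.le

/-! ### `log max{e, ·}` -/

/-- Monotonicity of `t ↦ log max{e, t}`. [folklore] -/
theorem log_max_exp_mono {t₁ t₂ : ℝ} (h : t₁ ≤ t₂) :
    Real.log (max (Real.exp 1) t₁) ≤ Real.log (max (Real.exp 1) t₂) :=
  Real.log_le_log (lt_max_of_lt_left (Real.exp_pos 1)) (max_le_max le_rfl h)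

/-- `log max{e, p·t} ≤ log p + log max{e, t}` for `p ≥ 1`. [folklore] -/
theorem log_max_exp_mul_le {p t : ℝ} (hp : 1 ≤ p) :
    Real.log (max (Real.exp 1) (p * t)) ≤ Real.log p + Real.log (max (Real.exp 1) t) := by
  have hm : 0 < max (Real.exp 1) t := lt_max_of_lt_left (Real.exp_pos 1)
  rw [← Real.log_mul (by linarith) hm.ne']
  refine Real.log_le_log (lt_max_of_lt_left (Real.exp_pos 1)) (max_le ?_ ?_)
  · calc Real.exp 1 = 1 * Real.exp 1 := (one_mul _).symm
      _ ≤ p * max (Real.exp 1) t :=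
          mul_le_mul hp (le_max_left _ _) (Real.exp_pos 1).le (by linarith)
  · exact mul_le_mul_of_nonneg_left (le_max_right _ _) (by linarith)

/-- `log max{e, t} ≤ log M` when `e ≤ M` and `t ≤ M`. [folklore] -/
theorem log_max_exp_le {t M : ℝ} (hM : Real.exp 1 ≤ M) (ht : t ≤ M) :
    Real.log (max (Real.exp 1) t) ≤ Real.log M :=
  Real.log_le_log (lt_max_of_lt_left (Real.exp_pos 1)) (max_le hM ht)

/-- `1 ≤ log max{e, t}`. [folklore] -/
theorem one_le_log_max_exp (t : ℝ) : 1 ≤ Real.log (max (Real.exp 1) t) := by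
  rw [← Real.log_exp 1]
  exact Real.log_le_log (Real.exp_pos 1) (by rw [Real.log_exp]; exact le_max_left _ _)

end Literature.NumberTheory.DiophantineGeometry.Pasten

end
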